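import Literature.MathematicalPhysics.QuantumFieldTheory.Balaban1983to89.B9Eq342CombesThomasBlockForm
import Literature.MathematicalPhysics.QuantumFieldTheory.Balaban1983to89.B9Thm31GpDecayOfCoerciveZd

/-!
# `Balaban1983to89.B9Eq349KernelCompositionZd` — [Balaban1985BackgroundPropagators] Thm 3.10 (3.107)–(3.108) pp. 415–416 ∕ [Balaban1984PropagatorsII] Lemma 2.1
# (2.61) p. 234: THE TWO PIECES OF KERNEL BOOKKEEPING EVERY LATER COMBES–THOMAS STATION NEEDS — (a) the block majorant of a COMPOSITION `S ∘ T` is the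
# matrix product of the majorants (carrier-generic, in the letters of `B9Eq342CombesThomasBlockForm`), (b) the product of two exponentially decaying kernels on
# `ℤᵈ` decays exponentially at half the rate, with the VOLUME-INDEPENDENT lattice sum `Σ_{z} e^{−μ|x−z|_∞} ≤ K_d(μ) := 3ᵈ·d!·(2∕μ)ᵈ·e^{μ∕2}∕(1 − e^{−μ∕2})`

statement-level skeleton of published theorems with citation tags; proofs where landed; nothing here is a claim about the
Yang–Mills mass gap

`[Balaban1985BackgroundPropagators]` ("B9", CMP **99** (1985) 389–434) pp. 415–416: the expansion (3.107) `G = Σ_ω …` is a sum of PRODUCTS of localized operators and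
its terms obey the product bound (3.108) («The constant O(1) depends on d and L only»); the exponentially decaying kernels of Thms 3.1 ∕ 3.3 ((3.42) p. 397)
compose along (3.25) (`R = I − G′Q′*(Q′G′²Q′*)⁻¹Q′G′`) and (3.26) (`Δ_a = Δ + DRD* + Q*aQ`).  [Balaban1984PropagatorsII] Lemma 2.1 (2.61) p. 234: the row sums
`Σ_{y′} e^{−δ d(y,y′)}` are bounded uniformly.  THIS FILE: the two [folklore] bookkeeping facts that turn «`G′` decays» (this seat's `B9Thm31GpDecayOfCoerciveZd`,
`…PlaqClosedZd`) into «`Q′G′²Q′*`, `R`, `DRD*` are almost-local» — the displayed inputs of the stations 2–5 of the Combes–Thomas road at the `ℤᵈ` frame.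

CITATION HEADER (lean-in-tree rule).  Cell `pub-ymgap` (YM Track A, HUMAN RULING D-0062 ∕ D-0149 width push), DAG node N06 = [B9], width seat
`pub-ymgap-dag-n06-w2` (g4), CLAIM-5.  Inputs BY NAME: `B9Eq342CombesThomasBlockForm.{blk, bsize, coord_apply_eq_sum_blk, bsize_sum_le, bsize_smul …}` (FILE C),
`B9Thm31GpDecayOfCoerciveZd.card_filter_linfDist_le` (FILE B), `LatticeNorms.linfDist`, Mathlib `Real.pow_div_factorial_le_exp`, `geom_sum_Ico_le_of_lt_one`.

WHAT IS PROVED (kernel, 0 sorry, 0 def).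
* §1 (carrier-generic) `blk_comp` · ★ `bsize_blk_comp_le` — if `|S_{xz}w| ≤ A(x,z)|w|` and `|T_{zy}w| ≤ B(z,y)|w|` on `s × s` then
  `|(S∘T)_{xy}w| ≤ (Σ_{z∈s} A(x,z)B(z,y))·|w|`.
* §2 (any pseudo-metric) ★ `exp_mul_exp_le_half` (`e^{−κd(x,z)}e^{−κd(z,y)} ≤ e^{−κd(x,y)∕2}·e^{−κd(x,z)∕2}`), `sum_exp_mul_exp_le` (the composed majorant
  `Σ_z C₁e^{−κd(x,z)}·C₂e^{−κd(z,y)} ≤ C₁C₂·e^{−κd(x,y)∕2}·Σ_z e^{−κd(x,z)∕2}`).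
* §3 (the lattice `ℤᵈ`, `ℓ∞` distance) `pow_succ_le_factorial_mul_exp` (`(n+1)ᵈ ≤ d!(2∕μ)ᵈe^{μ(n+1)∕2}`), ★★ `sum_exp_neg_mul_linfDist_le` —
  `Σ_{z∈s} e^{−μ|x−z|_∞} ≤ K_d(μ) = 3ᵈ·d!·(2∕μ)ᵈ·e^{μ∕2}∕(1 − e^{−μ∕2})` for EVERY finite `s ⊂ ℤᵈ` (`μ > 0`) — uniform in `s`; `sum_exp_neg_mul_linfDist_loc_le`
  (through a location map `loc : ι → ℤᵈ` with fibres of size `≤ m_F`: `≤ m_F·K_d(μ)`).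
* §4 ★★★ `sum_expMajorant_mul_le` — ON A `ℤᵈ`-LOCATED INDEX SET: majorants `C₁e^{−κ|·|_∞}`, `C₂e^{−κ|·|_∞}` (`κ > 0`) compose to
  `Σ_{z∈s} A(x,z)B(z,y) ≤ C₁C₂·m_F·K_d(κ∕2)·e^{−(κ∕2)|x−y|_∞}` — the input shape of `abs_cform_conj_sub_le_of_rowcol` ∕ `bsize_coord_le_exp_of_coercive_of_rowcol` for
  products; ★★ `rowsum_expMajorant_le` (an exponential majorant at rate `κ` has `(e^{κ′|·|_∞} − 1)`-weighted row sums `≤ C·m_F·K_d(κ − κ′)` for `0 ≤ κ′ < κ`);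
  ★★ `rowsum_expMajorant_le_linear` (the same `≤ κ′·(2∕(κ−κ′))·C·m_F·K_d((κ−κ′)∕2)` — SMALL with the conjugation rate `κ′`, the form the Combes–Thomas window
  `ϱ < c` consumes), with `mul_exp_neg_le_inv` (the one-liner `eᵗ − 1 ≤ teᵗ` is kept private — it is `AreaLaw.exp_sub_one_le_mul_exp` elsewhere in the tree).

HONEST SCOPE.  [folklore] bookkeeping; no estimate of [B9] is proved; the constant `K_d(μ)` is crude (any summable majorant of `Σ_n (2n+1)ᵈe^{−μn}` would do) and
blows up like `μ^{−d}` — NOT print's «O(1) depends on d and L only».  Count-neutral; N05 ∕ N06 NOT discharged; K1⁸ `stmt-QuantumFields-26907` NOT closed; one finite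
`𝕋⁴` programme at fixed `ε`, Bałaban as printed; R4 closes only the conditional finite-`𝕋⁴` rung `BalabanLadder.UV` — nothing continuum ∕ ℝ⁴ ∕ OS ∕ mass gap ∕
Clay.  Unit `pub-ymgap-dag-n06-w2` (g4), 2026-08-28.
-/

noncomputable section

open scoped BigOperators Nat

namespace Literature.MathematicalPhysics.QuantumFieldTheory.Balaban1983to89.B9Eq349KernelCompositionZd

open B9Eq342CombesThomasBlockForm
open B9Thm31GpDecayOfCoerciveZd (card_filter_linfDist_le)
open LatticeNorms (linfDist linfDist_le_iff)

export B7Prop1Explicit (Site)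

/-! ## §1  The block majorant of a composition is the product of the majorants -/

section Composition

variable {ι : Type*} {V : Type*} [AddCommGroup V] [Module ℝ V] {F : Type*} [AddCommGroup F] [Module ℝ F]
  {β : LinearMap.BilinForm ℝ F} {π : ι → V →ₗ[ℝ] F} {σ : ι → F →ₗ[ℝ] V} {s : Finset ι}

/-- the block of a composition: `(S∘T)_{xy}w = π_x(S(T(σ_y w)))`. [cite: Balaban1985BackgroundPropagators, (3.107) p.415 (bookkeeping)] -/
theorem blk_comp (S T : V →ₗ[ℝ] V) (x y : ι) (w : F) : blk π σ (S.comp T) x y w = π x (S (T (σ y w))) := rfl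

/-- ★ **THE MAJORANT OF A COMPOSITION IS THE PRODUCT OF THE MAJORANTS**: `|S_{xz}w| ≤ A(x,z)|w|`, `|T_{zy}w| ≤ B(z,y)|w|` on `s × s` ⟹
`|(S∘T)_{xy}w| ≤ (Σ_{z∈s} A(x,z)B(z,y))·|w|` (`x, y ∈ s`, `β` symmetric non-negative). [cite: Balaban1985BackgroundPropagators, (3.107)–(3.108) pp.415–416] -/
theorem bsize_blk_comp_le (hβs : ∀ u v, β u v = β v u) (hβ0 : ∀ v, 0 ≤ β v v) (hrec : ∀ v : V, ∑ i ∈ s, σ i (π i v) = v)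
    (S T : V →ₗ[ℝ] V) (A B : ι → ι → ℝ) (hA : ∀ x z, 0 ≤ A x z)
    (hS : ∀ x ∈ s, ∀ z ∈ s, ∀ w : F, bsize β (blk π σ S x z w) ≤ A x z * bsize β w)
    (hT : ∀ z ∈ s, ∀ y ∈ s, ∀ w : F, bsize β (blk π σ T z y w) ≤ B z y * bsize β w)
    {x y : ι} (hx : x ∈ s) (hy : y ∈ s) (w : F) :
    bsize β (blk π σ (S.comp T) x y w) ≤ (∑ z ∈ s, A x z * B z y) * bsize β w := by
  rw [blk_comp, coord_apply_eq_sum_blk hrec S]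
  refine (bsize_sum_le hβs hβ0 _ _).trans ?_
  rw [Finset.sum_mul]
  refine Finset.sum_le_sum fun z hz => ?_
  calc bsize β (blk π σ S x z (π z (T (σ y w)))) ≤ A x z * bsize β (π z (T (σ y w))) := hS x hx z hz _
    _ ≤ A x z * (B z y * bsize β w) := mul_le_mul_of_nonneg_left (hT z hz y hy w) (hA x z)
    _ = A x z * B z y * bsize β w := by ring

end Composition

/-! ## §2  Two exponential kernels compose at half the rate (any pseudo-metric) -/

section HalfRate

variable {ι : Type*}

/-- ★ `e^{−κd(x,z)}·e^{−κd(z,y)} ≤ e^{−κd(x,y)∕2}·e^{−κd(x,z)∕2}` (triangle inequality, `κ, d ≥ 0`). [folklore]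
[cite: Balaban1984PropagatorsII, Lemma 2.1 (2.61) p.234 (bookkeeping); Balaban1985BackgroundPropagators, (3.108) p.416] -/
theorem exp_mul_exp_le_half {dist : ι → ι → ℝ} (hd : ∀ x y, 0 ≤ dist x y) (hdt : ∀ x y z, dist x z ≤ dist x y + dist y z) {κ : ℝ} (hκ : 0 ≤ κ)
    (x z y : ι) :
    Real.exp (-(κ * dist x z)) * Real.exp (-(κ * dist z y)) ≤ Real.exp (-(κ / 2 * dist x y)) * Real.exp (-(κ / 2 * dist x z)) := by
  rw [← Real.exp_add, ← Real.exp_add, Real.exp_le_exp]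
  have h1 := hdt x z y
  have h2 := hd z y
  have h3 := hd x z
  nlinarith [mul_nonneg hκ h2, mul_nonneg hκ h3]

/-- **THE COMPOSED EXPONENTIAL MAJORANT**: `Σ_{z∈s} C₁e^{−κd(x,z)}·C₂e^{−κd(z,y)} ≤ C₁C₂·e^{−(κ∕2)d(x,y)}·Σ_{z∈s} e^{−(κ∕2)d(x,z)}` (`C₁, C₂, κ ≥ 0`).
[cite: Balaban1984PropagatorsII, Lemma 2.1 (2.61) p.234; Balaban1985BackgroundPropagators, (3.108) p.416] -/
theorem sum_exp_mul_exp_le {dist : ι → ι → ℝ} (hd : ∀ x y, 0 ≤ dist x y) (hdt : ∀ x y z, dist x z ≤ dist x y + dist y z) {κ C₁ C₂ : ℝ}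
    (hκ : 0 ≤ κ) (hC₁ : 0 ≤ C₁) (hC₂ : 0 ≤ C₂) (s : Finset ι) (x y : ι) :
    ∑ z ∈ s, C₁ * Real.exp (-(κ * dist x z)) * (C₂ * Real.exp (-(κ * dist z y))) ≤
      C₁ * C₂ * Real.exp (-(κ / 2 * dist x y)) * ∑ z ∈ s, Real.exp (-(κ / 2 * dist x z)) := by
  rw [Finset.mul_sum]
  refine Finset.sum_le_sum fun z _ => ?_
  have h := exp_mul_exp_le_half hd hdt hκ x z y
  have hC := mul_nonneg hC₁ hC₂
  calc C₁ * Real.exp (-(κ * dist x z)) * (C₂ * Real.exp (-(κ * dist z y)))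
      = C₁ * C₂ * (Real.exp (-(κ * dist x z)) * Real.exp (-(κ * dist z y))) := by ring
    _ ≤ C₁ * C₂ * (Real.exp (-(κ / 2 * dist x y)) * Real.exp (-(κ / 2 * dist x z))) := mul_le_mul_of_nonneg_left h hC
    _ = C₁ * C₂ * Real.exp (-(κ / 2 * dist x y)) * Real.exp (-(κ / 2 * dist x z)) := by ring

end HalfRate

/-! ## §3  The lattice sum `Σ_{z} e^{−μ|x−z|_∞} ≤ K_d(μ)`, uniformly in the finite region -/

section LatticeSum

variable {d : ℕ}

/-- `(n+1)ᵈ ≤ d!·(2∕μ)ᵈ·e^{μ(n+1)∕2}` (`μ > 0`; from `tᵈ∕d! ≤ eᵗ` at `t = μ(n+1)∕2`). [folklore]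
[cite: Balaban1984PropagatorsII, Lemma 2.1 (2.61) p.234 (bookkeeping)] -/
theorem pow_succ_le_factorial_mul_exp {μ : ℝ} (hμ : 0 < μ) (n : ℕ) :
    ((n : ℝ) + 1) ^ d ≤ (d ! : ℝ) * (2 / μ) ^ d * Real.exp (μ * ((n : ℝ) + 1) / 2) := by
  have ht : 0 ≤ μ * ((n : ℝ) + 1) / 2 := by positivity
  have h := Real.pow_div_factorial_le_exp _ ht d
  have hfac : (0 : ℝ) < d ! := by exact_mod_cast Nat.factorial_pos d
  rw [div_le_iff₀ hfac] at h
  -- `(μ(n+1)∕2)ᵈ = (μ∕2)ᵈ (n+1)ᵈ`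
  have hsplit : (μ * ((n : ℝ) + 1) / 2) ^ d = (μ / 2) ^ d * ((n : ℝ) + 1) ^ d := by rw [← mul_pow]; ring_nf
  rw [hsplit] at h
  have hμ2 : (0 : ℝ) < (μ / 2) ^ d := by positivity
  have hinv : (2 / μ) ^ d * (μ / 2) ^ d = 1 := by
    rw [← mul_pow, show 2 / μ * (μ / 2) = 1 by field_simp, one_pow]
  calc ((n : ℝ) + 1) ^ d = (2 / μ) ^ d * ((μ / 2) ^ d * ((n : ℝ) + 1) ^ d) := by rw [← mul_assoc, hinv, one_mul]
    _ ≤ (2 / μ) ^ d * (Real.exp (μ * ((n : ℝ) + 1) / 2) * d !) := mul_le_mul_of_nonneg_left h (by positivity)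
    _ = (d ! : ℝ) * (2 / μ) ^ d * Real.exp (μ * ((n : ℝ) + 1) / 2) := by ring

/-- `(2n+1)ᵈ e^{−μn} ≤ 3ᵈ·d!·(2∕μ)ᵈ·e^{μ∕2}·(e^{−μ∕2})ⁿ`. [folklore] [cite: Balaban1984PropagatorsII, Lemma 2.1 (2.61) p.234 (bookkeeping)] -/
theorem shell_term_le {μ : ℝ} (hμ : 0 < μ) (n : ℕ) :
    ((2 * n + 1 : ℕ) : ℝ) ^ d * Real.exp (-(μ * n)) ≤
      (3 : ℝ) ^ d * (d ! : ℝ) * (2 / μ) ^ d * Real.exp (μ / 2) * Real.exp (-(μ / 2)) ^ n := by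
  have h1 : ((2 * n + 1 : ℕ) : ℝ) ^ d ≤ (3 : ℝ) ^ d * (((n : ℝ) + 1) ^ d) := by
    rw [← mul_pow]
    exact pow_le_pow_left₀ (by positivity) (by push_cast; linarith) d
  have h2 := pow_succ_le_factorial_mul_exp (d := d) hμ n
  have hexp : Real.exp (μ * ((n : ℝ) + 1) / 2) * Real.exp (-(μ * n)) = Real.exp (μ / 2) * Real.exp (-(μ / 2)) ^ n := by
    rw [← Real.exp_nat_mul, ← Real.exp_add, ← Real.exp_add]
    congr 1; ring
  calc ((2 * n + 1 : ℕ) : ℝ) ^ d * Real.exp (-(μ * n))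
      ≤ (3 : ℝ) ^ d * ((n : ℝ) + 1) ^ d * Real.exp (-(μ * n)) := mul_le_mul_of_nonneg_right h1 (Real.exp_pos _).le
    _ ≤ (3 : ℝ) ^ d * ((d ! : ℝ) * (2 / μ) ^ d * Real.exp (μ * ((n : ℝ) + 1) / 2)) * Real.exp (-(μ * n)) :=
        mul_le_mul_of_nonneg_right (mul_le_mul_of_nonneg_left h2 (by positivity)) (Real.exp_pos _).le
    _ = (3 : ℝ) ^ d * (d ! : ℝ) * (2 / μ) ^ d * (Real.exp (μ * ((n : ℝ) + 1) / 2) * Real.exp (-(μ * n))) := by ring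
    _ = (3 : ℝ) ^ d * (d ! : ℝ) * (2 / μ) ^ d * Real.exp (μ / 2) * Real.exp (-(μ / 2)) ^ n := by rw [hexp]; ring

/-- ★★ **THE LATTICE SUM, UNIFORM IN THE REGION**: for `μ > 0`, every finite `s ⊂ ℤᵈ` and every `x`,
`Σ_{z∈s} e^{−μ|x−z|_∞} ≤ K_d(μ) := 3ᵈ·d!·(2∕μ)ᵈ·e^{μ∕2}∕(1 − e^{−μ∕2})` (shells `|x−z|_∞ = n` have `≤ (2n+1)ᵈ` sites; geometric series).
[cite: Balaban1984PropagatorsII, Lemma 2.1 (2.61) p.234; Balaban1985BackgroundPropagators, (3.108) p.416 («The constant O(1) depends on d and L only»)] -/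
theorem sum_exp_neg_mul_linfDist_le {μ : ℝ} (hμ : 0 < μ) (s : Finset (Site d)) (x : Site d) :
    ∑ z ∈ s, Real.exp (-(μ * (linfDist x z : ℝ))) ≤
      (3 : ℝ) ^ d * (d ! : ℝ) * (2 / μ) ^ d * Real.exp (μ / 2) / (1 - Real.exp (-(μ / 2))) := by
  classical
  set q := Real.exp (-(μ / 2)) with hq
  have hq0 : 0 ≤ q := (Real.exp_pos _).le
  have hq1 : q < 1 := by rw [hq]; exact Real.exp_lt_one_iff.mpr (by linarith)
  set Cμ := (3 : ℝ) ^ d * (d ! : ℝ) * (2 / μ) ^ d * Real.exp (μ / 2) with hCμ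
  have hCμ0 : 0 ≤ Cμ := by rw [hCμ]; positivity
  -- shells
  set M := s.sup (fun z => linfDist x z) + 1 with hM
  have hfib : ∑ z ∈ s, Real.exp (-(μ * (linfDist x z : ℝ))) =
      ∑ n ∈ Finset.range M, ∑ z ∈ s.filter (fun z => linfDist x z = n), Real.exp (-(μ * (linfDist x z : ℝ))) := by
    rw [← Finset.sum_fiberwise_of_maps_to (g := fun z => linfDist x z) (t := Finset.range M)]
    intro z hz
    rw [Finset.mem_range, hM]
    exact Nat.lt_succ_of_le (Finset.le_sup (f := fun z => linfDist x z) hz)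
  rw [hfib]
  have hshell : ∀ n ∈ Finset.range M, ∑ z ∈ s.filter (fun z => linfDist x z = n), Real.exp (-(μ * (linfDist x z : ℝ))) ≤ Cμ * q ^ n := by
    intro n _
    have hcard : ((s.filter (fun z => linfDist x z = n)).card : ℝ) ≤ ((2 * n + 1 : ℕ) : ℝ) ^ d := by
      have h1 : (s.filter (fun z => linfDist x z = n)).card ≤ (s.filter (fun z => linfDist x z ≤ n)).card := by
        refine Finset.card_le_card fun z hz => ?_
        rw [Finset.mem_filter] at hz ⊢
        exact ⟨hz.1, hz.2.le⟩
      have h2 := card_filter_linfDist_le s x n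
      exact_mod_cast h1.trans h2
    calc ∑ z ∈ s.filter (fun z => linfDist x z = n), Real.exp (-(μ * (linfDist x z : ℝ)))
        = ∑ z ∈ s.filter (fun z => linfDist x z = n), Real.exp (-(μ * n)) := by
          refine Finset.sum_congr rfl fun z hz => ?_
          rw [Finset.mem_filter] at hz; rw [hz.2]
      _ = ((s.filter (fun z => linfDist x z = n)).card : ℝ) * Real.exp (-(μ * n)) := by rw [Finset.sum_const, nsmul_eq_mul]
      _ ≤ ((2 * n + 1 : ℕ) : ℝ) ^ d * Real.exp (-(μ * n)) := mul_le_mul_of_nonneg_right hcard (Real.exp_pos _).le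
      _ ≤ Cμ * q ^ n := by rw [hCμ, hq]; exact shell_term_le hμ n
  calc ∑ n ∈ Finset.range M, ∑ z ∈ s.filter (fun z => linfDist x z = n), Real.exp (-(μ * (linfDist x z : ℝ)))
      ≤ ∑ n ∈ Finset.range M, Cμ * q ^ n := Finset.sum_le_sum hshell
    _ = Cμ * ∑ n ∈ Finset.range M, q ^ n := by rw [Finset.mul_sum]
    _ ≤ Cμ * (1 / (1 - q)) := by
        refine mul_le_mul_of_nonneg_left ?_ hCμ0
        have h := geom_sum_Ico_le_of_lt_one (m := 0) (n := M) hq0 hq1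
        rw [pow_zero] at h
        rwa [Finset.range_eq_Ico]
    _ = Cμ / (1 - q) := by ring

/-- the same through a LOCATION MAP `loc : ι → ℤᵈ` with fibres of size `≤ m_F` on `s`: `Σ_{z∈s} e^{−μ|loc x − loc z|_∞} ≤ m_F·K_d(μ)`.
[cite: Balaban1984PropagatorsII, Lemma 2.1 (2.61) p.234 (bookkeeping)] -/
theorem sum_exp_neg_mul_linfDist_loc_le {ι : Type*} {μ : ℝ} (hμ : 0 < μ) (s : Finset ι) (loc : ι → Site d) {mF : ℕ}
    (hmF : ∀ p : Site d, (s.filter (fun z => loc z = p)).card ≤ mF) (x : ι) :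
    ∑ z ∈ s, Real.exp (-(μ * (linfDist (loc x) (loc z) : ℝ))) ≤
      mF * ((3 : ℝ) ^ d * (d ! : ℝ) * (2 / μ) ^ d * Real.exp (μ / 2) / (1 - Real.exp (-(μ / 2)))) := by
  classical
  rw [← Finset.sum_fiberwise_of_maps_to (g := loc) (t := s.image loc) (fun z hz => Finset.mem_image_of_mem loc hz)]
  have hfib : ∀ p ∈ s.image loc, ∑ z ∈ s.filter (fun z => loc z = p), Real.exp (-(μ * (linfDist (loc x) (loc z) : ℝ))) ≤
      mF * Real.exp (-(μ * (linfDist (loc x) p : ℝ))) := by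
    intro p _
    calc ∑ z ∈ s.filter (fun z => loc z = p), Real.exp (-(μ * (linfDist (loc x) (loc z) : ℝ)))
        = ∑ z ∈ s.filter (fun z => loc z = p), Real.exp (-(μ * (linfDist (loc x) p : ℝ))) := by
          refine Finset.sum_congr rfl fun z hz => ?_
          rw [Finset.mem_filter] at hz; rw [hz.2]
      _ = ((s.filter (fun z => loc z = p)).card : ℝ) * Real.exp (-(μ * (linfDist (loc x) p : ℝ))) := by
          rw [Finset.sum_const, nsmul_eq_mul]
      _ ≤ mF * Real.exp (-(μ * (linfDist (loc x) p : ℝ))) := mul_le_mul_of_nonneg_right (by exact_mod_cast hmF p) (Real.exp_pos _).le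
  refine (Finset.sum_le_sum hfib).trans ?_
  rw [← Finset.mul_sum]
  exact mul_le_mul_of_nonneg_left (sum_exp_neg_mul_linfDist_le hμ _ _) (Nat.cast_nonneg _)

end LatticeSum

/-! ## §4  Composition and row sums of exponential majorants on a `ℤᵈ`-located index set -/

section Located

variable {d : ℕ} {ι : Type*}

/-- ★★★ **EXPONENTIAL MAJORANTS COMPOSE ON A `ℤᵈ`-LOCATED INDEX SET**: with `dist(x,y) = |loc x − loc y|_∞`, fibres of `loc` of size `≤ m_F` on `s`, and
`A(x,z) ≤ C₁e^{−κ dist(x,z)}`, `B(z,y) ≤ C₂e^{−κ dist(z,y)}` (`κ > 0`, `C₁, C₂ ≥ 0`, `A, B ≥ 0`):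
`Σ_{z∈s} A(x,z)B(z,y) ≤ C₁C₂·m_F·K_d(κ∕2)·e^{−(κ∕2) dist(x,y)}` — the majorant of `S∘T` from those of `S`, `T` (with §1's `bsize_blk_comp_le`).
[cite: Balaban1985BackgroundPropagators, (3.107)–(3.108) pp.415–416, (3.25)–(3.26) pp.394–395; Balaban1984PropagatorsII, Lemma 2.1 (2.61) p.234] -/
theorem sum_expMajorant_mul_le (s : Finset ι) (loc : ι → Site d) {mF : ℕ} (hmF : ∀ p : Site d, (s.filter (fun z => loc z = p)).card ≤ mF)
    {κ C₁ C₂ : ℝ} (hκ : 0 < κ) (hC₁ : 0 ≤ C₁) (hC₂ : 0 ≤ C₂) (A B : ι → ι → ℝ) (hA0 : ∀ x z, 0 ≤ A x z) (hB0 : ∀ z y, 0 ≤ B z y)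
    (hA : ∀ x z, A x z ≤ C₁ * Real.exp (-(κ * (linfDist (loc x) (loc z) : ℝ))))
    (hB : ∀ z y, B z y ≤ C₂ * Real.exp (-(κ * (linfDist (loc z) (loc y) : ℝ)))) (x y : ι) :
    ∑ z ∈ s, A x z * B z y ≤
      C₁ * C₂ * (mF * ((3 : ℝ) ^ d * (d ! : ℝ) * (2 / (κ / 2)) ^ d * Real.exp (κ / 2 / 2) / (1 - Real.exp (-(κ / 2 / 2))))) *
        Real.exp (-(κ / 2 * (linfDist (loc x) (loc y) : ℝ))) := by
  have hdist0 : ∀ a b : ι, (0 : ℝ) ≤ (linfDist (loc a) (loc b) : ℝ) := fun a b => Nat.cast_nonneg _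
  have hdt : ∀ a b c : ι, (linfDist (loc a) (loc c) : ℝ) ≤ (linfDist (loc a) (loc b) : ℝ) + (linfDist (loc b) (loc c) : ℝ) :=
    fun a b c => by exact_mod_cast LatticeNorms.linfDist_triangle (loc a) (loc b) (loc c)
  have h1 : ∑ z ∈ s, A x z * B z y ≤ ∑ z ∈ s, C₁ * Real.exp (-(κ * (linfDist (loc x) (loc z) : ℝ))) * (C₂ * Real.exp (-(κ * (linfDist (loc z) (loc y) : ℝ)))) :=
    Finset.sum_le_sum fun z _ => mul_le_mul (hA x z) (hB z y) (hB0 z y) ((hA0 x z).trans (hA x z))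
  have h2 := sum_exp_mul_exp_le (dist := fun a b : ι => (linfDist (loc a) (loc b) : ℝ)) hdist0 hdt hκ.le hC₁ hC₂ s x y
  have h3 := sum_exp_neg_mul_linfDist_loc_le (d := d) (half_pos hκ) s loc hmF x
  have hK : 0 ≤ C₁ * C₂ * Real.exp (-(κ / 2 * (linfDist (loc x) (loc y) : ℝ))) := by positivity
  calc ∑ z ∈ s, A x z * B z y ≤ _ := h1
    _ ≤ C₁ * C₂ * Real.exp (-(κ / 2 * (linfDist (loc x) (loc y) : ℝ))) * ∑ z ∈ s, Real.exp (-(κ / 2 * (linfDist (loc x) (loc z) : ℝ))) := h2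
    _ ≤ C₁ * C₂ * Real.exp (-(κ / 2 * (linfDist (loc x) (loc y) : ℝ))) *
          (mF * ((3 : ℝ) ^ d * (d ! : ℝ) * (2 / (κ / 2)) ^ d * Real.exp (κ / 2 / 2) / (1 - Real.exp (-(κ / 2 / 2))))) :=
        mul_le_mul_of_nonneg_left h3 hK
    _ = _ := by ring

/-- ★★ **ROW SUMS OF AN EXPONENTIAL MAJORANT AGAINST A SLOWER CONJUGATION WEIGHT**: `A(x,y) ≤ C·e^{−κ dist(x,y)}` and `0 ≤ κ′ < κ` ⟹
`Σ_{y∈s} A(x,y)·(e^{κ′dist(x,y)} − 1) ≤ C·m_F·K_d(κ − κ′)` (since `e^{−κd}(e^{κ′d} − 1) ≤ e^{−(κ−κ′)d}`) — the `hrow`∕`hcol` input of the almost-local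
Combes–Thomas bound for an exponentially localized operator. [cite: Balaban1988RG2Cluster, (2.16) p.16; Balaban1985BackgroundPropagators, (3.108) p.416] -/
theorem rowsum_expMajorant_le (s : Finset ι) (loc : ι → Site d) {mF : ℕ} (hmF : ∀ p : Site d, (s.filter (fun z => loc z = p)).card ≤ mF)
    {κ κ' C : ℝ} (hκ' : 0 ≤ κ') (hκκ : κ' < κ) (hC : 0 ≤ C) (A : ι → ι → ℝ)
    (hA : ∀ x y, A x y ≤ C * Real.exp (-(κ * (linfDist (loc x) (loc y) : ℝ)))) (x : ι) :
    ∑ y ∈ s, A x y * (Real.exp (κ' * (linfDist (loc x) (loc y) : ℝ)) - 1) ≤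
      C * (mF * ((3 : ℝ) ^ d * (d ! : ℝ) * (2 / (κ - κ')) ^ d * Real.exp ((κ - κ') / 2) / (1 - Real.exp (-((κ - κ') / 2))))) := by
  have hμ : 0 < κ - κ' := by linarith
  have hterm : ∀ y ∈ s, A x y * (Real.exp (κ' * (linfDist (loc x) (loc y) : ℝ)) - 1) ≤ C * Real.exp (-((κ - κ') * (linfDist (loc x) (loc y) : ℝ))) := by
    intro y _
    set t : ℝ := (linfDist (loc x) (loc y) : ℝ) with ht
    have ht0 : 0 ≤ t := Nat.cast_nonneg _
    have hw : Real.exp (κ' * t) - 1 ≤ Real.exp (κ' * t) := by linarith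
    have hw0 : 0 ≤ Real.exp (κ' * t) - 1 := by linarith [Real.one_le_exp (mul_nonneg hκ' ht0)]
    calc A x y * (Real.exp (κ' * t) - 1) ≤ C * Real.exp (-(κ * t)) * Real.exp (κ' * t) :=
          mul_le_mul (hA x y) hw hw0 (by positivity)
      _ = C * Real.exp (-((κ - κ') * t)) := by rw [mul_assoc, ← Real.exp_add]; congr 2; ring
  refine (Finset.sum_le_sum hterm).trans ?_
  rw [← Finset.mul_sum]
  exact mul_le_mul_of_nonneg_left (sum_exp_neg_mul_linfDist_loc_le hμ s loc hmF x) hC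

/-- `e^{t} − 1 ≤ t·e^{t}` (from `1 − t ≤ e^{−t}`). [folklore] [cite: Balaban1988RG2Cluster, (2.7) p.13 (bookkeeping)] -/
private theorem exp_sub_one_le_mul_exp (t : ℝ) : Real.exp t - 1 ≤ t * Real.exp t := by
  have h := Real.add_one_le_exp (-t)
  have hpos := Real.exp_pos t
  have hprod : Real.exp t * Real.exp (-t) = 1 := by rw [← Real.exp_add, add_neg_cancel, Real.exp_zero]
  nlinarith [mul_le_mul_of_nonneg_left h hpos.le]

/-- `t·e^{−μt} ≤ 1∕μ` for `t ≥ 0`, `μ > 0` (from `μt ≤ e^{μt}`). [folklore] [cite: Balaban1988RG2Cluster, (2.7) p.13 (bookkeeping)] -/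
theorem mul_exp_neg_le_inv {t μ : ℝ} (ht : 0 ≤ t) (hμ : 0 < μ) : t * Real.exp (-(μ * t)) ≤ 1 / μ := by
  have h := Real.add_one_le_exp (μ * t)
  have hpos := Real.exp_pos (μ * t)
  have hprod : Real.exp (μ * t) * Real.exp (-(μ * t)) = 1 := by rw [← Real.exp_add, add_neg_cancel, Real.exp_zero]
  rw [le_div_iff₀ hμ]
  have hμt : 0 ≤ μ * t := mul_nonneg hμ.le ht
  nlinarith [mul_le_mul_of_nonneg_right h (Real.exp_pos (-(μ * t))).le]

/-- ★★ **ROW SUMS WITH THE SMALL FACTOR `κ′`** (the form the Combes–Thomas window needs: it tends to `0` with the conjugation rate): `A(x,y) ≤ C·e^{−κ dist(x,y)}`,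
`0 ≤ κ′ < κ` ⟹ `Σ_{y∈s} A(x,y)·(e^{κ′dist(x,y)} − 1) ≤ κ′·(2∕(κ−κ′))·C·m_F·K_d((κ−κ′)∕2)` (via `e^{t} − 1 ≤ te^{t}` and `t e^{−μt} ≤ 1∕μ`, `μ = (κ−κ′)∕2`).
[cite: Balaban1988RG2Cluster, (2.7) p.13, (2.16) p.16; Balaban1985BackgroundPropagators, (3.108) p.416] -/
theorem rowsum_expMajorant_le_linear (s : Finset ι) (loc : ι → Site d) {mF : ℕ} (hmF : ∀ p : Site d, (s.filter (fun z => loc z = p)).card ≤ mF)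
    {κ κ' C : ℝ} (hκ' : 0 ≤ κ') (hκκ : κ' < κ) (hC : 0 ≤ C) (A : ι → ι → ℝ)
    (hA : ∀ x y, A x y ≤ C * Real.exp (-(κ * (linfDist (loc x) (loc y) : ℝ)))) (x : ι) :
    ∑ y ∈ s, A x y * (Real.exp (κ' * (linfDist (loc x) (loc y) : ℝ)) - 1) ≤
      κ' * (2 / (κ - κ')) * (C * (mF * ((3 : ℝ) ^ d * (d ! : ℝ) * (2 / ((κ - κ') / 2)) ^ d * Real.exp ((κ - κ') / 2 / 2) /
        (1 - Real.exp (-((κ - κ') / 2 / 2)))))) := by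
  set μ : ℝ := (κ - κ') / 2 with hμ
  have hμ0 : 0 < μ := by rw [hμ]; linarith
  have hterm : ∀ y ∈ s, A x y * (Real.exp (κ' * (linfDist (loc x) (loc y) : ℝ)) - 1) ≤
      κ' * (1 / μ) * (C * Real.exp (-(μ * (linfDist (loc x) (loc y) : ℝ)))) := by
    intro y _
    set t : ℝ := (linfDist (loc x) (loc y) : ℝ) with ht
    have ht0 : 0 ≤ t := Nat.cast_nonneg _
    have hw0 : 0 ≤ Real.exp (κ' * t) - 1 := by linarith [Real.one_le_exp (mul_nonneg hκ' ht0)]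
    have h1 : Real.exp (κ' * t) - 1 ≤ (κ' * t) * Real.exp (κ' * t) := exp_sub_one_le_mul_exp (κ' * t)
    have h2 : t * Real.exp (-(μ * t)) ≤ 1 / μ := mul_exp_neg_le_inv ht0 hμ0
    -- `A·(e^{κ′t} − 1) ≤ C e^{−κt}·κ′t e^{κ′t} = κ′ C·(t e^{−μt})·e^{−μt}` since `κ − κ′ = 2μ`
    have hsplit : C * Real.exp (-(κ * t)) * (κ' * t * Real.exp (κ' * t)) = κ' * C * (t * Real.exp (-(μ * t))) * Real.exp (-(μ * t)) := by
      have : -(κ * t) + κ' * t = -(μ * t) + -(μ * t) := by rw [hμ]; ring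
      calc C * Real.exp (-(κ * t)) * (κ' * t * Real.exp (κ' * t)) = κ' * C * t * (Real.exp (-(κ * t)) * Real.exp (κ' * t)) := by ring
        _ = κ' * C * t * (Real.exp (-(μ * t)) * Real.exp (-(μ * t))) := by rw [← Real.exp_add, this, Real.exp_add]
        _ = κ' * C * (t * Real.exp (-(μ * t))) * Real.exp (-(μ * t)) := by ring
    calc A x y * (Real.exp (κ' * t) - 1) ≤ C * Real.exp (-(κ * t)) * (κ' * t * Real.exp (κ' * t)) :=
          mul_le_mul (hA x y) h1 hw0 (by positivity)
      _ = κ' * C * (t * Real.exp (-(μ * t))) * Real.exp (-(μ * t)) := hsplit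
      _ ≤ κ' * C * (1 / μ) * Real.exp (-(μ * t)) := by
          refine mul_le_mul_of_nonneg_right (mul_le_mul_of_nonneg_left h2 (mul_nonneg hκ' hC)) (Real.exp_pos _).le
      _ = κ' * (1 / μ) * (C * Real.exp (-(μ * t))) := by ring
  refine (Finset.sum_le_sum hterm).trans ?_
  rw [← Finset.mul_sum, ← Finset.mul_sum]
  have hsum := sum_exp_neg_mul_linfDist_loc_le (d := d) hμ0 s loc hmF x
  have h1μ : (1 : ℝ) / μ = 2 / (κ - κ') := by rw [hμ]; field_simp
  rw [h1μ]
  have hfac : 0 ≤ κ' * (2 / (κ - κ')) := mul_nonneg hκ' (div_nonneg zero_le_two (by linarith))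
  refine mul_le_mul_of_nonneg_left (mul_le_mul_of_nonneg_left ?_ hC) hfac
  simpa [hμ] using hsum

end Located

end Literature.MathematicalPhysics.QuantumFieldTheory.Balaban1983to89.B9Eq349KernelCompositionZd

end
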